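import Mathlib
import Summits.Ventures.PercRepro2.TwoHullMaster

/-!
# The two-hull master statement with a pinned region around `l` (blind cell PercRepro2, night-4
g39, 2026-08-29; proofs/NIGHT4-G39.md §5)

(MM) of TwoHullMaster.lean conditioned on the colouring of a region `Uᶜ ∋ l` that the hull of `h`
avoids — the classes `outClass U h ξ` of the lane's (HLC) / (M) (SwOut.lean, SwMaster.lean): for
every up-set of pairs `𝓦l` for `l`, every up-set of pairs `𝓦h` for `h`, every region `U ∋ h` with
`l ∉ U` and every outside colouring `ξ`,

  `#{outClass U h ξ, h ∉ H_l, (C_R(l), C_B(l)) ∈ 𝓦l, (C_R(h), C_B(h)) ∈ 𝓦h}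
     ≤ #{outClass U h ξ, h ∉ H_l, (C_R(l), C_B(l)) ∈ 𝓦l, (C_B(h), C_R(h)) ∈ 𝓦h}`.

The region sits at the vertex whose pair is NOT mirrored: the mirror placement (a pinned region
around `h` avoided by `l`'s hull, `h`'s pair mirrored) fails from `n = 5` (289 / 11,216 tests), while
the symmetric one (that region with `l`'s pair mirrored) is the same statement with the roles
exchanged (0 failures).  `TwoHullMasterOut` contains the master conditioning (M) = `SwMaster`
(`𝓦h` a rectangle; `swMaster_of_twoHullMasterOut`, by the Hall lemma `exists_sw_injection_of_card_le`
on an arbitrary finite set of configurations) and, in the rigid form, the rigid (HLC) = `SwOutAll`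
(`swOutAll_of_twoHullMasterRigidOut`).  Census (own code mining/night-4/g39/mmreg*.py; random regions
`W ∋ l`, `h ∉ W`, a pinned colouring sampled from the class, principal × principal over the occurring
generators): `n = 5`: 375 classes, 11,144 tests; `n = 6` (all graphs, vertex form, `m ≤ 11`):
1,993 classes, 169,920 tests; `n = 6` (all graphs, edge form): 1,524 classes, 572,300 tests;
`n = 7` (kit j331468): vertex form on ALL 853 graphs, 16,722 cases, 14,994 classes, 3,689,182
tests, edge form `m ≤ 10`, 9,116 classes, 5,511,164 tests — 0 failures.  A CONJECTURE typed, not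
a theorem.

* `twoHullClassOut`, `twoHullClassEOut`, **`TwoHullMasterOut`**, **`TwoHullMasterRigidOut`**;
* `exists_sw_injection_of_card_le` — Hall for the cluster relation on any finite set;
* `swMaster_of_twoHullMasterOut`, `swOutAll_of_twoHullMasterRigidOut`, `twoHullMaster_of_out`,
  `twoHullMasterRigid_of_out` (the region `{l}ᶜ`: the unregioned forms follow).
-/

namespace Summit.Ventures.PercRepro2

namespace LocRows

open Hull

variable {V : Type*} {E : Type*} [Fintype E] [DecidableEq E]

open scoped Classical

variable (ends : E → Sym2 V)

/-- The two-hull class inside the outside class of the region `U` and the colouring `ξ`. -/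
noncomputable def twoHullClassOut (l h : V) (𝓦l 𝓦h : Set (Set V × Set V)) (U : Set V)
    (ξ : Config E) : Finset (Config E) :=
  twoHullClass ends l h 𝓦l 𝓦h ∩ outClass ends U h ξ

/-- The rigid two-hull class inside the outside class. -/
noncomputable def twoHullClassEOut (l h : V) (𝓦l : Set (Set V × Set V))
    (𝓦h : Set (Set E × Set E)) (U : Set V) (ξ : Config E) : Finset (Config E) :=
  twoHullClassE ends l h 𝓦l 𝓦h ∩ outClass ends U h ξ

/-- **(MM) with a region**: for every up-set of pairs `𝓦l`, `𝓦h`, every region `U ∋ h` with `l ∉ U`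
and every outside colouring `ξ`, the two-hull class in `outClass U h ξ` with `𝓦h` is at most as large
as the one with `𝓦h` mirrored. -/
def TwoHullMasterOut (l h : V) : Prop :=
  ∀ (𝓦l 𝓦h : Set (Set V × Set V)) (U : Set V) (ξ : Config E), IsPairUpSet 𝓦l → IsPairUpSet 𝓦h →
    h ∈ U → l ∉ U →
      (twoHullClassOut ends l h 𝓦l 𝓦h U ξ).card ≤
        (twoHullClassOut ends l h 𝓦l (mirror 𝓦h) U ξ).card

/-- **The rigid (MM) with a region.** -/
def TwoHullMasterRigidOut (l h : V) : Prop :=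
  ∀ (𝓦l : Set (Set V × Set V)) (𝓦h : Set (Set E × Set E)) (U : Set V) (ξ : Config E),
    IsPairUpSet 𝓦l → IsPairUpSetE 𝓦h → h ∈ U → l ∉ U →
      (twoHullClassEOut ends l h 𝓦l 𝓦h U ξ).card ≤
        (twoHullClassEOut ends l h 𝓦l (mirror 𝓦h) U ξ).card

variable {ends}

/-- Membership in the regioned two-hull class. -/
lemma mem_twoHullClassOut {l h : V} {𝓦l 𝓦h : Set (Set V × Set V)} {U : Set V} {ξ ζ : Config E} :
    ζ ∈ twoHullClassOut ends l h 𝓦l 𝓦h U ξ ↔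
      ζ ∈ twoHullClass ends l h 𝓦l 𝓦h ∧ ζ ∈ outClass ends U h ξ := by
  simp only [twoHullClassOut, Finset.mem_inter]

/-- Membership in the regioned rigid two-hull class. -/
lemma mem_twoHullClassEOut {l h : V} {𝓦l : Set (Set V × Set V)} {𝓦h : Set (Set E × Set E)}
    {U : Set V} {ξ ζ : Config E} :
    ζ ∈ twoHullClassEOut ends l h 𝓦l 𝓦h U ξ ↔
      ζ ∈ twoHullClassE ends l h 𝓦l 𝓦h ∧ ζ ∈ outClass ends U h ξ := by
  simp only [twoHullClassEOut, Finset.mem_inter]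

omit [DecidableEq E] in
/-- **Hall for the cluster relation** on an arbitrary finite set of configurations: if
`#{C_R(h) ∈ 𝓥} ≤ #{C_B(h) ∈ 𝓥}` for every up-set `𝓥` of vertex sets, then there is an injection of
the set into itself carrying the red cluster of `h` into the blue cluster of `h` of the image. -/
theorem exists_sw_injection_of_card_le (h : V) (Q₀ : Finset (Config E))
    (hc : ∀ 𝓥 : Set (Set V), IsUpperSet 𝓥 →
      (Q₀.filter fun ζ => cluster ends ζ h ∈ 𝓥).card ≤
        (Q₀.filter fun ζ => cluster ends (blue ζ) h ∈ 𝓥).card) :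
    ∃ f : {ζ // ζ ∈ Q₀} → Config E, Function.Injective f ∧
      ∀ x, f x ∈ Q₀ ∧ cluster ends x.1 h ⊆ cluster ends (blue (f x)) h := by
  let t : {ζ // ζ ∈ Q₀} → Finset (Config E) := fun x =>
    Q₀.filter fun ζ' => cluster ends x.1 h ⊆ cluster ends (blue ζ') h
  have hall : ∀ s : Finset {ζ // ζ ∈ Q₀}, s.card ≤ (s.biUnion t).card := by
    intro s
    let 𝓥 : Set (Set V) := {S | ∃ x ∈ s, cluster ends x.1 h ⊆ S}
    have h𝓥 : IsUpperSet 𝓥 := by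
      intro S S' hSS' ⟨x, hx, hxS⟩
      exact ⟨x, hx, hxS.trans hSS'⟩
    have e1 : s.biUnion t = Q₀.filter fun ζ' => cluster ends (blue ζ') h ∈ 𝓥 := by
      ext ζ'
      simp only [Finset.mem_biUnion, Finset.mem_filter, t, 𝓥, Set.mem_setOf_eq]
      constructor
      · rintro ⟨x, hx, hζ', hsub⟩
        exact ⟨hζ', x, hx, hsub⟩
      · rintro ⟨hζ', x, hx, hsub⟩
        exact ⟨x, hx, hζ', hsub⟩
    have e2 : s.card ≤ (Q₀.filter fun ζ => cluster ends ζ h ∈ 𝓥).card := by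
      refine Finset.card_le_card_of_injOn (fun x => x.1) ?_ ?_
      · intro x hx
        rw [Finset.mem_coe] at hx
        simp only [Finset.mem_coe, Finset.mem_filter]
        exact ⟨x.2, x, hx, le_rfl⟩
      · intro x _ y _ hxy
        exact Subtype.ext hxy
    rw [e1]
    refine e2.trans ?_
    convert hc 𝓥 h𝓥 using 2 <;> first | rfl | congr 1
  obtain ⟨f, hf, hft⟩ := (Finset.all_card_le_biUnion_card_iff_exists_injective t).1 hall
  refine ⟨f, hf, fun x => ?_⟩
  have hx := hft x
  simp only [t, Finset.mem_filter] at hx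
  exact hx

/-- The class of the master form (M) is the regioned two-hull class with the full set of pairs
for `h`; filtered by the red cluster of `h` it is the class of a first-coordinate rectangle. -/
lemma pairClass_filter_eq_twoHullClassOut (l h : V) (𝓦 : Set (Set V × Set V)) (U : Set V)
    (ξ : Config E) (𝓥 : Set (Set V)) :
    (pairClass ends l h 𝓦 U ξ).filter (fun ζ => cluster ends ζ h ∈ 𝓥) =
      twoHullClassOut ends l h 𝓦 {p : Set V × Set V | p.1 ∈ 𝓥} U ξ := by
  ext ζ
  rw [Finset.mem_filter, mem_pairClass, mem_twoHullClassOut, mem_twoHullClass]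
  simp only [hullPair, Set.mem_setOf_eq]
  tauto

/-- The mirrored rectangle: filtered by the blue cluster of `h`. -/
lemma pairClass_filter_blue_eq_twoHullClassOut (l h : V) (𝓦 : Set (Set V × Set V)) (U : Set V)
    (ξ : Config E) (𝓥 : Set (Set V)) :
    (pairClass ends l h 𝓦 U ξ).filter (fun ζ => cluster ends (blue ζ) h ∈ 𝓥) =
      twoHullClassOut ends l h 𝓦 (mirror {p : Set V × Set V | p.1 ∈ 𝓥}) U ξ := by
  ext ζ
  rw [Finset.mem_filter, mem_pairClass, mem_twoHullClassOut, mem_twoHullClass]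
  simp only [hullPair, Set.mem_setOf_eq, mem_mirror]
  tauto

/-- **The regioned (MM) gives the master conditioning (M)** by Hall's theorem on every class. -/
theorem swMaster_of_twoHullMasterOut {l h : V} (hm : TwoHullMasterOut ends l h) :
    SwMaster ends l h := by
  intro 𝓦 U ξ h𝓦 hU hl
  refine exists_sw_injection_of_card_le h _ fun 𝓥 h𝓥 => ?_
  rw [pairClass_filter_eq_twoHullClassOut, pairClass_filter_blue_eq_twoHullClassOut]
  exact hm _ _ U ξ h𝓦 (isPairUpSet_fst h𝓥) hU hl

/-- The side of (HLC) filtered by the red edges of `h` is a regioned rigid two-hull class. -/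
lemma swOutSide_filter_red_eq (l h o : V) (U : Set V) (ξ : Config E) (𝓔 : Set (Set E)) :
    (swOutSide ends l h o U ξ).filter (fun ζ => redEdges ends ζ h ∈ 𝓔) =
      twoHullClassEOut ends l h {p : Set V × Set V | o ∈ p.1 ∧ o ∉ p.2}
        {p : Set E × Set E | p.1 ∈ 𝓔} U ξ := by
  ext ζ
  rw [Finset.mem_filter, mem_swOutSide, mem_twoHullClassEOut, mem_twoHullClassE]
  simp only [tgtU, Finset.mem_filter, Finset.mem_univ, true_and, Set.mem_setOf_eq, hullPair,
    edgePair]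
  tauto

/-- The side of (HLC) filtered by the blue edges of `h` is the mirrored class. -/
lemma swOutSide_filter_blue_eq (l h o : V) (U : Set V) (ξ : Config E) (𝓔 : Set (Set E)) :
    (swOutSide ends l h o U ξ).filter (fun ζ => blueEdges ends ζ h ∈ 𝓔) =
      twoHullClassEOut ends l h {p : Set V × Set V | o ∈ p.1 ∧ o ∉ p.2}
        (mirror {p : Set E × Set E | p.1 ∈ 𝓔}) U ξ := by
  ext ζ
  rw [Finset.mem_filter, mem_swOutSide, mem_twoHullClassEOut, mem_twoHullClassE]
  simp only [tgtU, Finset.mem_filter, Finset.mem_univ, true_and, Set.mem_setOf_eq, hullPair,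
    edgePair, mem_mirror]
  tauto

/-- **The regioned rigid (MM) gives the rigid (HLC)** `SwOutAll`. -/
theorem swOutAll_of_twoHullMasterRigidOut {l h : V} (o : V) (hm : TwoHullMasterRigidOut ends l h) :
    SwOutAll ends l h o := by
  refine swOutAll_of_card_le l h o fun U ξ hU hl 𝓔 h𝓔 => ?_
  rw [swOutSide_filter_red_eq, swOutSide_filter_blue_eq]
  exact hm _ _ U ξ (isPairUpSet_side o) (isPairUpSetE_fst h𝓔) hU hl

/-- **The unregioned (MM) follows from the regioned one** with the region `{l}ᶜ`: the classes are
indexed by the canonical representative `outRep {l}ᶜ ζ` (the loops at `l` set blue) and partition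
the two-hull class, on both sides alike. -/
theorem twoHullMaster_of_out {l h : V} (hlh : l ≠ h) (hm : TwoHullMasterOut ends l h) :
    TwoHullMaster ends l h := by
  intro 𝓦l 𝓦h h𝓦l h𝓦h
  have hU : h ∈ ({l}ᶜ : Set V) := by simpa using hlh.symm
  have hl : l ∉ ({l}ᶜ : Set V) := by simp
  -- the representatives
  let S : Finset (Config E) := Finset.univ.image (outRep ends ({l}ᶜ))
  have key : ∀ 𝓦 : Set (Set V × Set V), (twoHullClass ends l h 𝓦l 𝓦).card =
      ∑ ξ ∈ S, (twoHullClassOut ends l h 𝓦l 𝓦 ({l}ᶜ) ξ).card := by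
    intro 𝓦
    rw [Finset.card_eq_sum_card_fiberwise (f := outRep ends ({l}ᶜ)) (t := S)
      (fun ζ _ => Finset.mem_image_of_mem _ (Finset.mem_univ ζ))]
    refine Finset.sum_congr rfl fun ξ hξ => ?_
    obtain ⟨ζ₀, -, rfl⟩ := Finset.mem_image.1 hξ
    congr 1
    ext ζ
    rw [Finset.mem_filter, mem_twoHullClassOut, mem_outClass]
    constructor
    · rintro ⟨hζ, hrep⟩
      refine ⟨hζ, ?_, ?_⟩
      · intro e he
        rw [← congrFun hrep e]
        simp only [outRep, he, if_false]
      · intro x hx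
        rw [mem_twoHullClass] at hζ
        simp only [Set.mem_compl_iff, Set.mem_singleton_iff]
        rintro rfl
        apply hζ.1
        rcases hx with hx | hx
        · exact Or.inl (conn_symm hx)
        · exact Or.inr (conn_symm hx)
    · rintro ⟨hζ, hagree, -⟩
      have idem : ∀ x : Config E,
          outRep ends ({l}ᶜ) (outRep ends ({l}ᶜ) x) = outRep ends ({l}ᶜ) x := fun x => by
        funext e
        simp only [outRep]
        split_ifs <;> rfl
      have h2 : outRep ends ({l}ᶜ) ζ = outRep ends ({l}ᶜ) (outRep ends ({l}ᶜ) ζ₀) :=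
        outRep_eq_of_agree hagree
      rw [idem] at h2
      exact ⟨hζ, h2⟩
  rw [key, key]
  exact Finset.sum_le_sum fun ξ _ => hm 𝓦l 𝓦h ({l}ᶜ) ξ h𝓦l h𝓦h hU hl

end LocRows

end Summit.Ventures.PercRepro2
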